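import Mathlib
import Summits.ValiantsHypothesis.ValiantsHypothesis.Theorems.MonotoneRestorationOrbitRestorationQPLevelStructureB
import HarnessLib

/-!
# Structure of symmetric `ΣΠΣ(k)` circuits, III: untwisting and the structure theorem at a level (ORBIT currency)

Route MonotoneRestoration, crux `OrbitRestorationQP` (stmt-ValiantsHypothesis-18293), line `depth-three-rung`, registered stub
`stub_sigmaPiSigmaKValue` (A_k).  Namespace `Summit.ValiantsHypothesis.ValiantsHypothesis.Theorems.LevelStructure`.  Route-independent.

Layer L5 (d) of the formalisation plan of `Cruxes/OrbitRestorationQP/Lines/depth-three-rung-stubA-bounded-fanin.md` (§2 (f), second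
half, and the conclusion of Theorem S), continuing `…LevelStructureA/B.lean`:

* `rowChar`, `colChar` — the scalars by which row / column permutations act on `Π linPart (F_a)` form multiplicative characters of
  `Sym(Fin n)`, hence take the values `±1` (`…ProductAction.eq_one_or_eq_neg_one`);
* `not_mact_eq_neg` — UNTWISTING BY MINIMALITY: no `mact σ τ` maps a nonzero cluster sum to its negative (the image is again a
  cluster sum, and two cluster sums never cancel in a minimal representation);
* `mact_linProd` — hence `Π linPart (F_a)` is fixed by the whole matrix action;
* `structure_level` — **THEOREM S AT A LEVEL**: `f = Σ_a u_a · Π Lin_a · Q_a(U)` with every `Π Lin_a` a matrix-symmetric product of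
  at most `D` polynomials of degree `1` and `Q_a` univariate, `U = Σ x_{pq}`.

Everything is proved modulo the named fact `depthThree_rankBound`, taken BY NAME as a hypothesis. [cite: KarninShpilka2009, §3;
SaxenaSeshadhri2013, Theorem 5]
-/

noncomputable section

open MvPolynomial Equiv Literature.Computability.AlgebraicComplexity

-- `Summit.ValiantsHypothesis.ValiantsHypothesis.…` is the tree's single-conjunct layout (Sub = Summit).
set_option linter.dupNamespace false

namespace Summit.ValiantsHypothesis.ValiantsHypothesis.Theorems

namespace LevelStructure

open RankDistance LinNL LinearSubalgebra ProductAction LevelRep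

variable {n : ℕ}

namespace Setting

variable {D : ℕ} (S : Setting n D)

/-- The numerical side conditions of the structure theorem at a level, for the exponent `c`. [folklore] -/
structure Hyps (c : ℕ) : Prop where
  hc1 : S.R.m * D < n.choose (c + 2)
  hc2 : 4 * (c + 2) ≤ n
  hc3 : c + 7 ≤ n
  hdim : 4 * (S.R.m * (1 + S.R.m ^ 2 * S.Θ)) + 8 ≤ n

/-- The product of the linear factors of the cluster sum of `a`. [folklore] -/
def linProd (a : Fin S.R.m) : MvPolynomial (Fin n × Fin n) ℂ := (linPart (S.F a)).prod

/-- `linProd a ≠ 0`. [folklore] -/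
theorem linProd_ne_zero (a : Fin S.R.m) : S.linProd a ≠ 0 := by
  rw [linProd, Ne, Multiset.prod_eq_zero_iff]
  intro h
  have := totalDegree_of_mem_linPart h
  rw [totalDegree_zero] at this
  exact zero_ne_one this

/-- Rows fix `Fall`. [folklore] -/
theorem row_Fall (hRB : depthThree_rankBound) (ρ : Perm (Fin n)) : vact (K := ℂ) rowHom ρ S.Fall = S.Fall := by
  rw [vact_rowHom_eq]; exact S.mact_Fall hRB ρ 1

/-- Columns fix `Fall`. [folklore] -/
theorem col_Fall (hRB : depthThree_rankBound) (ρ : Perm (Fin n)) : vact (K := ℂ) colHom ρ S.Fall = S.Fall := by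
  rw [vact_colHom_eq]; exact S.mact_Fall hRB 1 ρ

/-- The row scalars. [folklore] -/
theorem exists_rowChar (hRB : depthThree_rankBound) {c : ℕ} (hH : S.Hyps c) {a : Fin S.R.m} (ha : a ∈ S.labs) :
    ∃ χ : Perm (Fin n) → ℂ, (∀ σ, vact (K := ℂ) rowHom σ (S.linProd a) = C (χ σ) * S.linProd a) ∧ χ 1 = 1 ∧
      (∀ σ σ', χ (σ * σ') = χ σ * χ σ') := by
  choose χ hχ0 hχ1 using fun σ => S.exists_C_mul_linProd hRB isLocal_rowHom (S.rowFix_clusterSum hRB) (S.row_Fall hRB) hH.hc1 hH.hc2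
    hH.hc3 ha σ
  have hχ : ∀ σ, vact (K := ℂ) rowHom σ (S.linProd a) = C (χ σ) * S.linProd a := fun σ => hχ1 σ
  have hne := S.linProd_ne_zero a
  refine ⟨χ, hχ, ?_, fun σ σ' => ?_⟩
  · have h := hχ 1
    rw [map_one, AlgEquiv.one_apply] at h
    have : C (χ 1) * S.linProd a = C 1 * S.linProd a := by rw [← h, C_1, one_mul]
    exact C_injective _ _ (mul_right_cancel₀ hne this)
  · have hC : ∀ (ρ : Perm (Fin n)) (t : ℂ), vact (K := ℂ) rowHom ρ (C t) = C t := fun ρ t => by simp [vact_apply]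
    have h1 : vact (K := ℂ) rowHom (σ * σ') (S.linProd a) = C (χ σ * χ σ') * S.linProd a := by
      rw [map_mul, AlgEquiv.mul_apply, hχ σ', map_mul, hC, hχ σ, map_mul]; ring
    rw [hχ (σ * σ')] at h1
    exact C_injective _ _ (mul_right_cancel₀ hne h1)

/-- The column scalars. [folklore] -/
theorem exists_colChar (hRB : depthThree_rankBound) {c : ℕ} (hH : S.Hyps c) {a : Fin S.R.m} (ha : a ∈ S.labs) :
    ∃ χ : Perm (Fin n) → ℂ, (∀ τ, vact (K := ℂ) colHom τ (S.linProd a) = C (χ τ) * S.linProd a) ∧ χ 1 = 1 ∧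
      (∀ τ τ', χ (τ * τ') = χ τ * χ τ') := by
  choose χ hχ0 hχ1 using fun τ => S.exists_C_mul_linProd hRB isLocal_colHom (S.colFix_clusterSum hRB) (S.col_Fall hRB) hH.hc1 hH.hc2
    hH.hc3 ha τ
  have hχ : ∀ τ, vact (K := ℂ) colHom τ (S.linProd a) = C (χ τ) * S.linProd a := fun τ => hχ1 τ
  have hne := S.linProd_ne_zero a
  refine ⟨χ, hχ, ?_, fun τ τ' => ?_⟩
  · have h := hχ 1
    rw [map_one, AlgEquiv.one_apply] at h
    have : C (χ 1) * S.linProd a = C 1 * S.linProd a := by rw [← h, C_1, one_mul]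
    exact C_injective _ _ (mul_right_cancel₀ hne this)
  · have hC : ∀ (ρ : Perm (Fin n)) (t : ℂ), vact (K := ℂ) colHom ρ (C t) = C t := fun ρ t => by simp [vact_apply]
    have h1 : vact (K := ℂ) colHom (τ * τ') (S.linProd a) = C (χ τ * χ τ') * S.linProd a := by
      rw [map_mul, AlgEquiv.mul_apply, hχ τ', map_mul, hC, hχ τ, map_mul]; ring
    rw [hχ (τ * τ')] at h1
    exact C_injective _ _ (mul_right_cancel₀ hne h1)

/-- **UNTWISTING BY MINIMALITY**: no `mact σ τ` maps a nonzero cluster sum to its negative. [folklore] -/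
theorem not_mact_eq_neg (hRB : depthThree_rankBound) {a : Fin S.R.m} (ha : a ∈ S.labs) (σ τ : Perm (Fin n))
    (h : mact σ τ (S.F a) = -S.F a) : False := by
  classical
  obtain ⟨a', ha'⟩ := (S.perm_clusterSum hRB σ τ).2 a
  rw [h] at ha'
  -- `F a' = - F a`
  by_cases haa : a' = a
  · subst haa
    have h2 : (2 : ℂ) • S.F a' = 0 := by rw [two_smul]; nth_rewrite 1 [← ha']; rw [neg_add_cancel]
    exact S.F_ne_zero ha ((smul_eq_zero.1 h2).resolve_left two_ne_zero)
  · -- the fibres of `a` and `a'` together form a vanishing sub-family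
    have hdisj : Disjoint (S.fibre a) (S.fibre a') := by
      rw [Finset.disjoint_left]
      intro i hi hi'
      simp only [Setting.fibre, Finset.mem_filter] at hi hi'
      exact haa (hi'.2.symm.trans hi.2)
    refine S.R.hmin (S.fibre a ∪ S.fibre a') ?_ ?_
    · obtain ⟨i, hi⟩ := S.fibre_nonempty ha
      exact ⟨i, Finset.mem_union_left _ hi⟩
    · rw [Finset.sum_union hdisj]
      change S.F a + S.F a' = 0
      rw [← ha', add_neg_cancel]

/-- **`Π linPart (F_a)` is fixed by the whole matrix action.** [folklore] -/
theorem mact_linProd (hRB : depthThree_rankBound) {c : ℕ} (hH : S.Hyps c) {a : Fin S.R.m} (ha : a ∈ S.labs) (σ τ : Perm (Fin n)) :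
    mact σ τ (S.linProd a) = S.linProd a := by
  obtain ⟨χr, hχr, hχr1, hχrm⟩ := S.exists_rowChar hRB hH ha
  obtain ⟨χc, hχc, hχc1, hχcm⟩ := S.exists_colChar hRB hH ha
  obtain ⟨Q, hQ, hQfix⟩ := S.exists_aeval_U hRB hH.hdim ha
  obtain ⟨u, hu, hFe⟩ := exists_eq_C_mul (S.F_ne_zero ha)
  have hCrow : ∀ (ρ : Perm (Fin n)) (t : ℂ), vact (K := ℂ) rowHom ρ (C t) = C t := fun ρ t => by simp [vact_apply]
  have hCcol : ∀ (ρ : Perm (Fin n)) (t : ℂ), vact (K := ℂ) colHom ρ (C t) = C t := fun ρ t => by simp [vact_apply]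
  -- the action on `F a` is multiplication by `χr σ * χc τ`
  have hact : ∀ σ τ : Perm (Fin n), mact σ τ (S.F a) = C (χr σ * χc τ) * S.F a := by
    intro σ τ
    have hnl : mact σ τ (nlPart (S.F a)) = nlPart (S.F a) := hQfix σ τ
    rw [mact, AlgEquiv.trans_apply] at hnl ⊢
    conv_lhs => rw [hFe]
    rw [map_mul, map_mul, map_mul, map_mul, hCcol, hCrow]
    have h1 : vact (K := ℂ) rowHom σ (vact (K := ℂ) colHom τ (linPart (S.F a)).prod) = C (χr σ * χc τ) * (linPart (S.F a)).prod := by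
      change vact (K := ℂ) rowHom σ (vact (K := ℂ) colHom τ (S.linProd a)) = C (χr σ * χc τ) * S.linProd a
      rw [hχc, map_mul, hCrow, hχr, map_mul]; ring
    rw [h1, hnl]
    conv_rhs => rw [hFe]
    ring
  -- the characters take the values `±1`, and `-1` is excluded by minimality
  have hone : ∀ σ τ : Perm (Fin n), χr σ * χc τ = 1 := by
    intro σ τ
    rcases eq_one_or_eq_neg_one χr hχr1 hχrm σ with h1 | h1 <;> rcases eq_one_or_eq_neg_one χc hχc1 hχcm τ with h2 | h2
    · rw [h1, h2, one_mul]
    · exfalso; refine S.not_mact_eq_neg hRB ha σ τ ?_; rw [hact, h1, h2]; simp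
    · exfalso; refine S.not_mact_eq_neg hRB ha σ τ ?_; rw [hact, h1, h2]; simp
    · rw [h1, h2]; norm_num
  have hr1 : ∀ σ : Perm (Fin n), χr σ = 1 := fun σ => by simpa [hχc1] using hone σ 1
  have hc1' : ∀ τ : Perm (Fin n), χc τ = 1 := fun τ => by simpa [hχr1] using hone 1 τ
  rw [mact, AlgEquiv.trans_apply, hχc, hc1', C_1, one_mul, hχr, hr1, C_1, one_mul]

/-- **THEOREM S AT A LEVEL.**  Under the side conditions `Hyps c`, a matrix-symmetric `f` with a clean minimal representation and a good
labelling decomposes as `f = Σ_a u_a · Π Lin_a · Q_a(U)`: each `Π Lin_a` is a product of at most `D` polynomials of degree `1` FIXED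
by the whole matrix action, `Q_a` is univariate, `U = Σ x_{pq}`. [cite: KarninShpilka2009, §3; SaxenaSeshadhri2013, Theorem 5] -/
theorem structure_level (hRB : depthThree_rankBound) {c : ℕ} (hH : S.Hyps c) :
    ∃ (u : Fin S.R.m → ℂ) (Lin : Fin S.R.m → Multiset (MvPolynomial (Fin n × Fin n) ℂ)) (Q : Fin S.R.m → Polynomial ℂ),
      (∀ a, ∀ q ∈ Lin a, q.totalDegree = 1) ∧ (∀ a, Multiset.card (Lin a) ≤ D) ∧
      (∀ a (σ τ : Perm (Fin n)), mact σ τ (Lin a).prod = (Lin a).prod) ∧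
      S.f = ∑ a, C (u a) * (Lin a).prod * Polynomial.aeval (U n) (Q a) := by
  classical
  -- per-label data
  have hdata : ∀ a, ∃ (u : ℂ) (Lin : Multiset (MvPolynomial (Fin n × Fin n) ℂ)) (Q : Polynomial ℂ),
      (∀ q ∈ Lin, q.totalDegree = 1) ∧ Multiset.card Lin ≤ D ∧ (∀ σ τ : Perm (Fin n), mact σ τ Lin.prod = Lin.prod) ∧
      S.F a = C u * Lin.prod * Polynomial.aeval (U n) Q := by
    intro a
    by_cases ha : a ∈ S.labs
    · obtain ⟨Q, hQ, -⟩ := S.exists_aeval_U hRB hH.hdim ha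
      obtain ⟨u, -, hFe⟩ := exists_eq_C_mul (S.F_ne_zero ha)
      refine ⟨u, linPart (S.F a), Q, fun q hq => totalDegree_of_mem_linPart hq,
        (card_linPart_le (S.F_ne_zero ha)).trans (S.totalDegree_F_le a), fun σ τ => S.mact_linProd hRB hH ha σ τ, ?_⟩
      rw [← hQ, mul_assoc]; exact hFe
    · refine ⟨0, 0, 0, by simp, by simp, fun σ τ => by simp, ?_⟩
      rw [C_0, zero_mul, zero_mul]
      exact S.R.clusterSum_eq_zero S.cl fun ⟨i, hi⟩ => ha (Finset.mem_image.2 ⟨i, Finset.mem_univ i, hi⟩)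
  choose u Lin Q h1 h2 h3 h4 using hdata
  refine ⟨u, Lin, Q, h1, h2, h3, ?_⟩
  have h := S.R.sum_clusterSum S.cl
  calc S.f = ∑ a, S.R.clusterSum S.cl a := h.symm
    _ = _ := Finset.sum_congr rfl fun a _ => h4 a

end Setting

end LevelStructure

end Summit.ValiantsHypothesis.ValiantsHypothesis.Theorems

end
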